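import Literature.AlgebraicGeometry.Frobenioids.Cor412Assembly
import Literature.AlgebraicGeometry.Frobenioids.IstrStandardTypeProofs
import Literature.AlgebraicGeometry.Frobenioids.EquivalenceThm34Assembly
import Literature.AlgebraicGeometry.Frobenioids.EquivalencePreStepsQuasiIsotropic
import HarnessLib

/-!
# Frobenioids I, Corollary 4.12 AS TYPED for Frobenioids over bases of FSM-type, modulo the named
# fact Theorem 3.4 (iv) and the two printed inputs at `(C^istr)^birat`

Mochizuki, *The geometry of Frobenioids I: the general theory*, Kyushu J. Math. **62** (2008)
293–400, kurims text, Cor. 4.12 p. 94 l. 44 – p. 95 l. 17, proof p. 95 ll. 18–40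
[cite: MochizukiFrdI2008, Cor. 4.12 p.95].

PROOF-ONLY closer (cell sub-DAG W9 = `plan/L1/SUBDAG-FrdI-Cor412.md`; seat abc-iut-w5-d222) of the node
`FrdI:Cor4.12`: the typed statement `PreFrobenioidData.Cor412 (ofFunctor Φ₁ F₁) (ofFunctor Φ₂ F₂) Ψ R₁ R₂`
(abc-iut-L1-t3) — whose own antecedents are the printed hypotheses "`D_i` Frobenius-slim", "`C_i` of
rationally standard type" (`IsOfRationallyStandardType R_i`, of which only `.standard` is used) and (b)
`HypB` — holds for EVERY pair of Frobenioids `C_i → F_{Φ_i}` over bases of FSM-type (the cell's repaired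
reading of print's "FSMFF-type" in Thm. 3.4 (ii)/(iii), `plan/GAP-LEDGER.md` residual R2) and every
equivalence `Ψ`, GIVEN: the named fact `FrdI.Thm34iv` ([FrdI] Thm. 3.4 (iv), abc-iut FACT-LIST F-0713;
its clause "`Ψ` preserves `O^×(−)`" is used, for `Ψ^birat`), and at the Frobenioids `C_i^istr` THE
birationalizations `(C_i^istr)^birat` with their Frobenioid structures over `0_{D_i}` (Prop. 4.4 (ii)
first sentence — hypothesis `hB_i`, verbatim as in `UnitTrivializationFrobeniusCompact.lean`) of standard
type (Prop. 4.8 (iii) — hypothesis `hstd_i`, verbatim the conclusion of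
`PreFrobenioidData.prop48iii_of_frobeniusCompact`). Everything else in print's proof is a theorem of the
tree: Thm. 3.4 (i) (`nonempty_isotropification_comp_iso`, abc-iut-w4-d088; `isotropicObjects_inverseImage`,
abc-iut-L1-t13), Rem. 4.5.1 (`isOfStandardType_istrData`, transported here to the full subcategory
`Istr F` as `isOfStandardType_istr`), Thm. 3.4 (ii) (`isCoAngularPreStep_map_of_quasiIsotropic_of_isOfFSMType`,
abc-iut-L1-t13), Thm. 3.4 (iii) (`thm34iii_ofFunctor_of_isOfFSMType`, abc-iut-w4-d033/w4-d088/L1-t13),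
Cor. 4.10 (`Birat.mapOfEquiv`, abc-iut-L1-t10), Prop. 4.4 (iv) (`Birat.isBaseIso_mapOfEquiv_map`,
abc-iut-L6-t20), Prop. 4.8 (i), Prop. 3.11 (i) (`FrdI.Prop311i_holds`), the unit-trivialization
(abc-iut-L1-d5/d6), "composing diagrams", `1`-uniqueness and rigidity (Prop. 1.13 (i)) —
`FrdI.cor412_of_thm34iv_istr` (`Cor412Assembly.lean`).

* `PreFrobenioid.isOfStandardType_istr`, `isOfGroupLikeType_of_istr'`: Rem. 4.5.1 / Def. 1.3 (vii)(a) for the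
  full subcategory `Istr F` (transport from abc-iut's `IstrStandardTypeProofs` along the propositional
  equality of the two "isotropic" object properties);
* `FrdI.hypB_istr`: hypothesis (b) passes from `Ψ` to its restriction `Ψ^istr`;
* `FrdI.cor412_of_thm34iv_of_isOfFSMType`: the closer.

No statement of the paper is restated as a `Prop` or strengthened; nothing here is specific to the abc
programme or bears on [IUTchIII] Cor. 3.12.
-/

namespace Literature.AlgebraicGeometry.Frobenioids

open CategoryTheory Opposite

universe w v v' u u'

namespace PreFrobenioid

section OneFrobenioid

variable {D : Type u} [Category.{v} D] {Φ : Dᵒᵖ ⥤ CommMonCat.{w}}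
  {C : Type u'} [Category.{v'} C] {F : C ⥤ ElemFrobenioid Φ}

/-- The §3 "isotropic" object property of the operations `ofFunctor Φ F` IS the §1 one of `F`
(propositional equality of object properties; cf. `isotropicObjects_le_ofFunctor`,
`isotropicObjects_ofFunctor_le`). [cite: MochizukiFrdI2008, Def. 1.2 (iv) p.23] -/
theorem isotropicObjects_ofFunctor_eq :
    (PreFrobenioidData.ofFunctor Φ F).isotropicObjects = isotropicObjects F :=
  funext fun A => propext (PreFrobenioidData.ofFunctor_isIsotropic F A)

/-- **Remark 4.5.1 (standard half) for the full subcategory `C^istr = Istr F`**: if `C → F_Φ` is a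
Frobenioid of standard type, then so is `C^istr → F_Φ` (abc-iut's `isOfStandardType_istrData`, transported
along `isotropicObjects_ofFunctor_eq`). [cite: MochizukiFrdI2008, Rem. 4.5.1 p.86] -/
theorem isOfStandardType_istr (hF : IsFrobenioid F) (hS : (PreFrobenioidData.ofFunctor Φ F).IsOfStandardType) :
    (PreFrobenioidData.ofFunctor Φ (istrFunctor F)).IsOfStandardType := by
  have key : ∀ {P : ObjectProperty C}, P = isotropicObjects F →
      (PreFrobenioidData.ofFunctor Φ (P.ι ⋙ F)).IsOfStandardType →
        (PreFrobenioidData.ofFunctor Φ (istrFunctor F)).IsOfStandardType := by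
    rintro P rfl h
    exact h
  exact key isotropicObjects_ofFunctor_eq (isOfStandardType_istrData F hF hS)

/-- **If `C^istr` (`Istr F`) is of group-like type then so is `C`** (`Φ(Base A) ≅ Φ(Base A^istr)` along an
isotropic hull, Def. 1.3 (vii)(a); abc-iut's `isOfGroupLikeType_of_istrData`, transported).
[cite: MochizukiFrdI2008, Def. 1.3 (vii) p.24] -/
theorem isOfGroupLikeType_of_istr' (hF : IsFrobenioid F)
    (h : (PreFrobenioidData.ofFunctor Φ (istrFunctor F)).IsOfGroupLikeType) :
    (PreFrobenioidData.ofFunctor Φ F).IsOfGroupLikeType := by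
  have key : ∀ {P : ObjectProperty C}, P = isotropicObjects F →
      (PreFrobenioidData.ofFunctor Φ (istrFunctor F)).IsOfGroupLikeType →
        (PreFrobenioidData.ofFunctor Φ (P.ι ⋙ F)).IsOfGroupLikeType := by
    rintro P rfl h
    exact h
  exact isOfGroupLikeType_of_istrData F hF (key isotropicObjects_ofFunctor_eq h)

end OneFrobenioid

end PreFrobenioid

namespace FrdI

open PreFrobenioid

variable {D₁ : Type u} [Category.{v} D₁] {Φ₁ : D₁ᵒᵖ ⥤ CommMonCat.{w}}
  {C₁ : Type u'} [Category.{v'} C₁] {F₁ : C₁ ⥤ ElemFrobenioid Φ₁}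
  {D₂ : Type u} [Category.{v} D₂] {Φ₂ : D₂ᵒᵖ ⥤ CommMonCat.{w}}
  {C₂ : Type u'} [Category.{v'} C₂] {F₂ : C₂ ⥤ ElemFrobenioid Φ₂}

/-- **Hypothesis (b) for the restriction `Ψ^istr`** ("if `C₁`, `C₂` are of group-like type, then both `Ψ`
and some quasi-inverse to `Ψ` preserve base-isomorphisms", p. 94 ll. 52–53): if it holds for `Ψ` it holds
for `Ψ^istr : C₁^istr ⥲ C₂^istr` (Thm. 3.4 (i)), since `C_i^istr` group-like forces `C_i` group-like and
base-isomorphisms of `C^istr` are those of `C`. [cite: MochizukiFrdI2008, Cor. 4.12 p.94] -/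
theorem hypB_istr (hF₁ : IsFrobenioid F₁) (hF₂ : IsFrobenioid F₂) (Ψ : C₁ ≌ C₂)
    [(isotropicObjects F₂).IsClosedUnderIsomorphisms]
    (h : (isotropicObjects F₂).inverseImage Ψ.functor = isotropicObjects F₁)
    (hB : (PreFrobenioidData.ofFunctor Φ₁ F₁).HypB (PreFrobenioidData.ofFunctor Φ₂ F₂) Ψ) :
    (PreFrobenioidData.ofFunctor Φ₁ (istrFunctor F₁)).HypB (PreFrobenioidData.ofFunctor Φ₂ (istrFunctor F₂))
      (Ψ.congrFullSubcategory h) := fun hg₁ hg₂ =>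
  have h' := hB (isOfGroupLikeType_of_istr' hF₁ hg₁) (isOfGroupLikeType_of_istr' hF₂ hg₂)
  ⟨fun _ _ f hf => h'.1 f.hom hf, fun _ _ f hf => h'.2 f.hom hf⟩

/-- **[FrdI] Corollary 4.12 AS TYPED, for Frobenioids over bases of FSM-type, from the named fact
Theorem 3.4 (iv) and the two printed inputs at `(C^istr)^birat`** (print p. 94 l. 44 – p. 95 l. 40): for
Frobenioids `C_i → F_{Φ_i}` over bases `D_i` of FSM-type and an equivalence `Ψ : C₁ ⥲ C₂`, GIVEN the named
fact `FrdI.Thm34iv` (F-0713; at the universes of the birationalizations), THE birationalizations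
`(C_i^istr)^birat` with their Frobenioid structures `(C_i^istr)^birat → F_{0_{D_i}}` (Prop. 4.4 (ii) first
sentence, `hB_i`) of standard type (Prop. 4.8 (iii), `hstd_i`), the typed Cor. 4.12 holds — i.e. under its
own printed hypotheses "`D_i` Frobenius-slim", "`C_i` of rationally standard type" (only "standard" is
used) and (b): "there exists a 1-unique functor `Ψ⁰ : F_{0_{D₁}} → F_{0_{D₂}}` that fits into a
1-commutative diagram [over the projections `C_i → F_{0_{D_i}}`] … Moreover, if `D₁`, `D₂` are slim, then
each of the composite functors of this diagram is rigid." Route = print's: reduction to `C^istr`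
(Thm. 3.4 (i), Rem. 4.5.1), Cor. 4.10, Prop. 4.4 (iv) + Thm. 3.4 (iii) (base-isomorphisms of `Ψ^birat`),
Thm. 3.4 (iv) (units of `Ψ^birat`), unit-trivialization, Prop. 3.11 (i), Prop. 1.13 (i).
[cite: MochizukiFrdI2008, Cor. 4.12 p.95] -/
theorem cor412_of_thm34iv_of_isOfFSMType (h34iv : Thm34iv.{w, v, max u' v', u, u'})
    (hF₁ : IsFrobenioid F₁) (hF₂ : IsFrobenioid F₂) (hD₁ : IsOfFSMType D₁) (hD₂ : IsOfFSMType D₂)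
    (hsq₁ : HasBiratSquares (istrFunctor F₁)) (hsq₂ : HasBiratSquares (istrFunctor F₂))
    (hB₁ : IsFrobenioid (Birat.toElemZero (isFrobenioid_istr hF₁) hsq₁))
    (hB₂ : IsFrobenioid (Birat.toElemZero (isFrobenioid_istr hF₂) hsq₂))
    (hstd₁ : (biratOps (isFrobenioid_istr hF₁) hsq₁).IsOfStandardType)
    (hstd₂ : (biratOps (isFrobenioid_istr hF₂) hsq₂).IsOfStandardType) (Ψ : C₁ ≌ C₂)
    (R₁ : (PreFrobenioidData.ofFunctor Φ₁ F₁).RSParams) (R₂ : (PreFrobenioidData.ofFunctor Φ₂ F₂).RSParams) :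
    (PreFrobenioidData.ofFunctor Φ₁ F₁).Cor412 (PreFrobenioidData.ofFunctor Φ₂ F₂) Ψ R₁ R₂ := by
  intro hfs₁ hfs₂ hR₁ hR₂ hB
  have hs₁ := hR₁.standard
  have hs₂ := hR₂.standard
  -- Thm. 3.4 (i): the restriction `Ψ^istr` and its square with the isotropifications
  haveI : (isotropicObjects F₂).IsClosedUnderIsomorphisms :=
    ⟨fun e hX => IsIsotropic.of_iso hF₂.isPreFrobenioid e.symm hX⟩
  have hinv := FrdI.isotropicObjects_inverseImage hF₁ hs₁.quasiIsotropic hs₂.quasiIsotropic Ψ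
  let Ψi : Istr F₁ ≌ Istr F₂ := Ψ.congrFullSubcategory hinv
  obtain ⟨core⟩ := nonempty_isotropification_comp_iso hF₁ hF₂ hs₁.quasiIsotropic hs₂.quasiIsotropic Ψ
  -- Rem. 4.5.1: `C_i^istr` of standard type; hypothesis (b) for `Ψ^istr` and for its inverse
  have hs₁' := isOfStandardType_istr hF₁ hs₁
  have hs₂' := isOfStandardType_istr hF₂ hs₂
  have hBi : (PreFrobenioidData.ofFunctor Φ₁ (istrFunctor F₁)).HypB
      (PreFrobenioidData.ofFunctor Φ₂ (istrFunctor F₂)) Ψi := hypB_istr hF₁ hF₂ Ψ hinv hB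
  have hBi' : (PreFrobenioidData.ofFunctor Φ₂ (istrFunctor F₂)).HypB
      (PreFrobenioidData.ofFunctor Φ₁ (istrFunctor F₁)) Ψi.symm :=
    fun hg₂ hg₁ => ⟨(hBi hg₁ hg₂).2, (hBi hg₁ hg₂).1⟩
  -- Thm. 3.4 (ii): `Ψ^istr`, `(Ψ^istr)⁻¹` preserve co-angular pre-steps (bases of FSM-type)
  have hΨ : ∀ ⦃A B : Istr F₁⦄ (f : A ⟶ B),
      IsCoAngularPreStep (istrFunctor F₁) f → IsCoAngularPreStep (istrFunctor F₂) (Ψi.functor.map f) :=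
    fun A B f hf => FrdI.isCoAngularPreStep_map_of_quasiIsotropic_of_isOfFSMType (isFrobenioid_istr hF₁)
      (isFrobenioid_istr hF₂) hs₁'.quasiIsotropic hs₂'.quasiIsotropic hD₂ Ψi hf
  have hΨ' : ∀ ⦃A B : Istr F₂⦄ (f : A ⟶ B),
      IsCoAngularPreStep (istrFunctor F₂) f → IsCoAngularPreStep (istrFunctor F₁) (Ψi.inverse.map f) :=
    fun A B f hf => FrdI.isCoAngularPreStep_map_of_quasiIsotropic_of_isOfFSMType (isFrobenioid_istr hF₂)
      (isFrobenioid_istr hF₁) hs₂'.quasiIsotropic hs₁'.quasiIsotropic hD₁ Ψi.symm hf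
  -- Thm. 3.4 (iii): `Ψ^istr`, `(Ψ^istr)⁻¹` preserve base-isomorphisms (bases of FSM-type)
  obtain ⟨⟨-, -, hbi, -, -, -, -⟩, -⟩ := FrdI.thm34iii_ofFunctor_of_isOfFSMType (isFrobenioid_istr hF₁)
    (isFrobenioid_istr hF₂) hD₁ hD₂ Ψi hs₁' hs₂' hBi
  obtain ⟨⟨-, -, hbi', -, -, -, -⟩, -⟩ := FrdI.thm34iii_ofFunctor_of_isOfFSMType (isFrobenioid_istr hF₂)
    (isFrobenioid_istr hF₁) hD₂ hD₁ Ψi.symm hs₂' hs₁' hBi'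
  exact cor412_of_thm34iv_istr h34iv hF₁ hF₂ Ψ Ψi core hsq₁ hsq₂ hB₁ hB₂ hstd₁ hstd₂ hfs₁ hfs₂ hΨ hΨ' hbi hbi'
    R₁ R₂ hfs₁ hfs₂ hR₁ hR₂ hB

end FrdI

end Literature.AlgebraicGeometry.Frobenioids
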